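import Literature.MathematicalPhysics.QuantumFieldTheory.Balaban1983to89.B7Eq162General
import Literature.MathematicalPhysics.QuantumFieldTheory.Balaban1983to89.B8Eq131Derivation
import Literature.MathematicalPhysics.QuantumFieldTheory.Balaban1983to89.B8Eq115GaugeFixing
import Literature.MathematicalPhysics.QuantumFieldTheory.Balaban1983to89.B8Ineq130
import HarnessLib

/-!
# Line H (`BirthV10.stub_halvingStep`, stmt-QuantumFields-19200) — (B-al-4)₃'s ω-ROW (F-ω), FILE 2: **THE AVERAGED GAUGE `R̄ʲu`** — by (84) `R̄ʲu = u(Lʲ·)·w_j` with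
# `w_j = \overline{R_{0,·}W}^{(j)}` (85) `= v_j` (99), the accumulated frames of the double-bar tower of the chart field, which (163) keeps within `64·d·Lʲ·b` of `1`
# UNIFORMLY IN THE NUMBER OF LEVELS; hence the in-block oscillation of `R̄ʲu` is FILE 1's `u`-sample oscillation up to `2·64dLʲb` (+ products)
# ([Balaban1985Averaging] (67) p.29, (78)–(80), (84) p.30, (85) p.31, (97), (99) p.32, (160)–(163) p.42)

Cell `ym3-torus` (HUMAN RULING D-0037: YM₃ on T³ is ladder rung R3 — NOT d = 4, NOT infinite volume, NOT a mass gap, NOT the Clay problem), width seat `ym3-torus-px9`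
gen 6 ((F-ω) = px9 g6 per the consumer ym-ust-20520-w3 g9 04:36:22Z, letters (α)(β); LEAD-H ★w5-19200 g7 WORD 21).  `--supports stmt-QuantumFields-19200 --as helper`;
THEOREMS ONLY (0 `def`, 0 `sorry`, standard axioms); count-neutral; nothing here claims (B-al-4)₃, the (b)-row, (M2′), the stub, the crux or the gap.

WHY.  The consumer's pyramid induction (✓p694594∕✓p696898 `HalvingEffGaugeTowerRatio[Local].norm_effGauge_ratio_le_of_pyramid[_local]`, skeleton `…HalvingEffGaugeRowG.hG_of_rows`
row `hOsc`) uses the reference family `A_j := (R̄ʲu₁ ∘ Lab_j)⁻¹`, `R̄ʲu₁ = uavg L 1 u₁ j` (lit ✓`B7Eq84Concrete.uavg`, (79)–(80) at the flat background), and displays its in-block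
oscillation `e_j`.  By (84) (lit ✓`B7Eq84Concrete.eq84`, or ✓`B8Eq131Derivation.eq84_local` under one site) `R̄ʲu(z) = u(Lʲz)·w_j(z)` as soon as `u•W` is block-axial in the
tower under `z`; by (99) (lit ✓`B7Eq99Concrete.wrec_eq_vcov`, no hypothesis) `w_j = v_j`, the accumulated frames (97)∕(160) of the double-bar tower of `W`; and by (163) at a
general regular background (lit ✓`B7Eq162General.eq163_general`, here at `U₀ := 1`, where (52) is free) `‖v_j − 1‖, ‖v_j⁻¹ − 1‖ ≤ e^{32dLʲb} − 1 ≤ 64dLʲb` for `W = e^{B}`, `‖B‖ ≤ b`,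
`2048·d·Lᵏb ≤ 1` — k-UNIFORM and geometric in `j`.  (A first design via the recursion (85) ∘ (0.8) was retracted before filing: its majorant carries a `160·a_j²` self-term and is
not k-uniform — bus px9 g6 05:0xZ; (99)+(163) is the printed linear route.)

WHAT (namespace `…Theorems.HalvingOmegaRowWrec`; `Site d = ℤᵈ`, any `d`; values in the units of a complete normed `ℂ`-algebra `𝔸` with `‖1‖ = 1`; `G` any gauge group closed under the
average, e.g. `U(N)`, `SU(N)`):
* §1 (67)∕(84) at the flat background: `axialGauge_flat_of_blockAxial` (block-axiality of `\overline{u•W}ʲ`, `j < k` ⇒ `AxialGauge L 1 W u k`), ★ `uavg_flat_eq` (`R̄ʲu(z) = u(Lʲz)·w_j(z)`,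
  GLOBAL axial hypothesis), ★ `uavg_flat_eq_local` (the same AT ONE SITE from block-axiality in the tower under it — what a chart that is only local can pay).
* §2 (99)+(163): `pdev_one_eq_zero`, ★★ `norm_wrec_flat_sub_one_le` — `W = expCfg B`, `‖B‖ ≤ b` (global), windows ⇒ `‖w_j(y) − 1‖ ≤ 64dLʲb` and `‖w_j(y)⁻¹ − 1‖ ≤ 64dLʲb`, `j ≤ k`.
* §3 ★★ `norm_inv_uavg_mul_uavg_sub_one_le` — (α): from (84) at the two points, FILE 1's sample bound `x` and §2's `a`: `‖R̄ʲu(Lc)⁻¹·R̄ʲu(Lc + r) − 1‖ ≤ x + 2a + (2a + a²)(1 + x) `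
  (pure algebra, NO unitarity — (γ) is the consumer's (P7), ym-ust-20520-w4 g11).
HONEST SCOPE.  Letters over landed lit theorems; the member instantiation (cut-off chart field, label boxes, `b = L^{−k}c′`, the choice of `α₀` at `U₀ = 1`) is FILE 3.

References: T. Bałaban, CMP **98** (1985) 17–51 [Balaban1985Averaging] ((52) p.26, (67) p.29, (78)–(80) p.30, (84) p.30, (85) p.31, (97), (99)–(100) p.32, (160)–(163) p.42);
CMP **99** (1985) 75–102 [Balaban1985RegularSpaces] ((1.15) p.78, (1.19) p.79, (1.29) p.81).
-/

set_option autoImplicit false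

noncomputable section

open scoped BigOperators

namespace Summit.QuantumFields.YangMills.Theorems.HalvingOmegaRowWrec

open Literature.MathematicalPhysics.QuantumFieldTheory.Balaban1983to89
open B7Prop1Explicit (Site e boxVec axialFn gaugeAct hol treeWord U1 mem_U1)
open B7Prop2Explicit (avgIter pdev C0 c2' AvgClosed)
open B7Prop3Flat (expCfg c3)
open B7AvgGaugeCovariance (uLev uLev_apply)
open B7Eq92Concrete (tHol tildIter vcov mgauge_one_left tHol_one_left tildIter_one_left avgIter_one)
open B7Eq99Concrete (wrec wrec_eq_vcov)
open B7Eq84Concrete (uavg eq84 AxialGauge)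
open B7Eq162General (eq163_general)
open B8Ineq132 (Under)
open B8Eq131Derivation (eq84_local)

variable {d : ℕ} {𝔸 : Type*} [NormedRing 𝔸] [NormedAlgebra ℂ 𝔸] [CompleteSpace 𝔸]

/-! ## §1 (67) and (84) at the flat background -/

/-- **(67) AT THE FLAT BACKGROUND FROM BLOCK-AXIALITY**: if `u•W = U′` and every `Ū′ʲ`, `j < k`, is block-axial (`Ū′ʲ(Γ_{Lz,Lz+r}) = 1`), then `AxialGauge L 1 W u k`
(`Ū₀ʲ = 1`, `Ũ′ʲ = Ū′ʲ`, twisted transport = transport). [cite: Balaban1985Averaging, (67) p.29, (69)-(71) p.29; Balaban1985RegularSpaces, (1.15) p.78, (1.19) p.79] -/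
theorem axialGauge_flat_of_blockAxial (L : ℕ) (U' W : Site d → Fin d → 𝔸ˣ) (u : Site d → 𝔸ˣ) (hR1 : gaugeAct u W = U') {k : ℕ}
    (hblk : ∀ j, j < k → ∀ (z : Site d) (r : Fin d → Fin L), axialFn (avgIter L U' j) ((L : ℤ) • z) ((L : ℤ) • z + boxVec L r) = 1) :
    AxialGauge L (1 : Site d → Fin d → 𝔸ˣ) W u k := by
  intro j hj z r
  rw [mgauge_one_left, hR1, avgIter_one, tildIter_one_left, tHol_one_left]
  have h := hblk j hj z r
  rwa [axialFn, add_sub_cancel_left] at h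

/-- ★ **(84) AT THE FLAT BACKGROUND** for a gauge `u` with `u•W = U′` block-axial below level `k` EVERYWHERE: `R̄ʲu(z) = u(Lʲz)·w_j(z)`, `j ≤ k`. [cite: Balaban1985Averaging, (84) p.30, (67) p.29] -/
theorem uavg_flat_eq (L : ℕ) (U' W : Site d → Fin d → 𝔸ˣ) (u : Site d → 𝔸ˣ) (hR1 : gaugeAct u W = U') {k : ℕ}
    (hblk : ∀ j, j < k → ∀ (z : Site d) (r : Fin d → Fin L), axialFn (avgIter L U' j) ((L : ℤ) • z) ((L : ℤ) • z + boxVec L r) = 1)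
    {j : ℕ} (hjk : j ≤ k) (z : Site d) :
    uavg L (1 : Site d → Fin d → 𝔸ˣ) u j z = u (((L : ℤ) ^ j) • z) * wrec L (1 : Site d → Fin d → 𝔸ˣ) W j z := by
  rw [eq84 L 1 W u (axialGauge_flat_of_blockAxial L U' W u hR1 hblk) j hjk]
  simp only [uLev_apply]

/-- ★ **(84) AT ONE SITE** (`L ≥ 1`): if `\overline{u•W}ⁿ` is block-axial at every block `B(Lz)` of the tower UNDER the level-`j` site `y` (`z ∈ B^{j−n−1}(y)`, `n < j`), then
`R̄ʲu(y) = u(Lʲy)·w_j(y)` — what a chart field known only on the fine block of `y` can pay (lit ✓`eq84_local`). [cite: Balaban1985Averaging, (84) p.30; Balaban1985RegularSpaces, (1.19) p.79, (1.29) p.81] -/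
theorem uavg_flat_eq_local (L : ℕ) (hL : 1 ≤ L) (W : Site d → Fin d → 𝔸ˣ) (u : Site d → 𝔸ˣ) (j : ℕ) (y : Site d)
    (hloc : ∀ n, n < j → ∀ z : Site d, Under L (j - (n + 1)) y z → ∀ r : Fin d → Fin L,
      axialFn (avgIter L (gaugeAct u W) n) ((L : ℤ) • z) ((L : ℤ) • z + boxVec L r) = 1) :
    uavg L (1 : Site d → Fin d → 𝔸ˣ) u j y = u (((L : ℤ) ^ j) • y) * wrec L (1 : Site d → Fin d → 𝔸ˣ) W j y := by
  have h := eq84_local L hL 1 W u j y fun n hn z hz r => by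
    rw [mgauge_one_left, avgIter_one, tildIter_one_left, tHol_one_left]
    have h := hloc n hn z hz r
    rwa [axialFn, add_sub_cancel_left] at h
  rw [h, uLev_apply]

/-! ## §2 (99) + (163): the block averages `w_j = v_j` stay within `64·d·Lʲ·b` of `1`, uniformly in the number of levels -/

omit [NormedAlgebra ℂ 𝔸] [CompleteSpace 𝔸] in
/-- the flat background transports trivially along every word ((9) at `V = 1`). [cite: Balaban1985Averaging, (9) p.18] -/
private theorem hol_one' : ∀ (x : Site d) (w : List (B7Prop1Explicit.Letter d)), hol (1 : Site d → Fin d → 𝔸ˣ) x w = 1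
  | _, [] => rfl
  | x, l :: w => by rw [B7Prop1Explicit.hol_cons, hol_one' (x + l.vec) w, mul_one]; simp [B7Prop1Explicit.stepHol]

omit [NormedAlgebra ℂ 𝔸] [CompleteSpace 𝔸] in
/-- (52) at the vacuum: the plaquette deviation of the flat background vanishes. [cite: Balaban1985Averaging, Prop. 2 (52) p.26, (9) p.18] -/
theorem pdev_one_eq_zero [NormOneClass 𝔸] : pdev (1 : Site d → Fin d → 𝔸ˣ) = 0 := by
  unfold pdev; simp [hol_one']

variable [NormOneClass 𝔸]

/-- ★★ **THE BLOCK AVERAGES `w_j = \overline{R_{0,·}W}^{(j)}` (85) OF A SMALL FIELD STAY NEAR `1`, UNIFORMLY IN THE NUMBER OF LEVELS** — (99) `w_j = v_j` and (163) at the flat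
background: for `W = e^{B}` with `‖B‖ ≤ b` everywhere, any `α₀ > 0` with Prop. 2's windows (free at `U₀ = 1`, where (52) reads `0 < α₀L^{−2k}`), and `2048·d·Lᵏb ≤ 1`,
`2Lᵏb ≤ c₃`, `e^{3200(d+1)²(d+4)α₀}(1 + 8·131072(d+1)²·Lᵏb) ≤ 2`: for every `j ≤ k` and every site `y`, `‖w_j(y) − 1‖ ≤ 64·d·Lʲb` and `‖w_j(y)⁻¹ − 1‖ ≤ 64·d·Lʲb`.
[cite: Balaban1985Averaging, (85) p.31, (99) p.32, (160)-(163) p.42, Prop. 2 (52) p.26] -/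
theorem norm_wrec_flat_sub_one_le (L : ℕ) (hL : 2 ≤ L) {G : Subgroup 𝔸ˣ} (hG : AvgClosed d L G) (k : ℕ)
    (B : Site d → Fin d → 𝔸) {b : ℝ} (hb : 0 ≤ b) (hB : ∀ x κ, ‖B x κ‖ ≤ b)
    {α₀ : ℝ} (hα : 0 < α₀) (hα3 : C0 d * α₀ ≤ 1 / 3) (hα4 : 4 * α₀ ≤ c2' d L)
    (hsmall : Real.exp (4 * (800 * ((d : ℝ) + 1) ^ 2 * ((d : ℝ) + 4)) * α₀) * (1 + 8 * (131072 * ((d : ℝ) + 1) ^ 2) * ((L : ℝ) ^ k * b)) ≤ 2)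
    (hc₃ : 2 * ((L : ℝ) ^ k * b) ≤ c3 d L) (hsm : 2048 * (d : ℝ) * ((L : ℝ) ^ k * b) ≤ 1)
    {j : ℕ} (hj : j ≤ k) (y : Site d) :
    ‖((wrec L (1 : Site d → Fin d → 𝔸ˣ) (expCfg B) j y : 𝔸ˣ) : 𝔸) - 1‖ ≤ 64 * (d : ℝ) * ((L : ℝ) ^ j * b) ∧
      ‖(((wrec L (1 : Site d → Fin d → 𝔸ˣ) (expCfg B) j y)⁻¹ : 𝔸ˣ) : 𝔸) - 1‖ ≤ 64 * (d : ℝ) * ((L : ℝ) ^ j * b) := by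
  have h52 : pdev (1 : Site d → Fin d → 𝔸ˣ) < α₀ * (((L : ℝ) ^ k)⁻¹) ^ 2 := by rw [pdev_one_eq_zero]; positivity
  obtain ⟨⟨h1, h2⟩, h64⟩ := eq163_general hL hG (U₀ := 1) (fun _ _ => G.one_mem) hα hα3 hα4 h52 hb hB hsmall hc₃ hsm hj y
  rw [wrec_eq_vcov]
  exact ⟨h1.trans h64, h2.trans h64⟩

/-! ## §3 (α): the in-block oscillation of `R̄ʲu` from FILE 1's sample bound and §2 -/

omit [NormedAlgebra ℂ 𝔸] [CompleteSpace 𝔸] [NormOneClass 𝔸] in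
/-- `‖P·X·Q − 1‖ ≤ x + p + q + pq + (p + q + pq)·x` from `‖X − 1‖ ≤ x`, `‖P − 1‖ ≤ p`, `‖Q − 1‖ ≤ q` (no unit-ball hypothesis). [folklore] -/
theorem norm_mul_mul_sub_one_le_of_sub_one {P X Q : 𝔸} {p x q : ℝ} (hP : ‖P - 1‖ ≤ p) (hX : ‖X - 1‖ ≤ x) (hQ : ‖Q - 1‖ ≤ q) :
    ‖P * X * Q - 1‖ ≤ x + p + q + p * q + (p + q + p * q) * x := by
  have hp0 : 0 ≤ p := (norm_nonneg _).trans hP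
  have hx0 : 0 ≤ x := (norm_nonneg _).trans hX
  have hq0 : 0 ≤ q := (norm_nonneg _).trans hQ
  set P' := P - 1 with hP'
  set X' := X - 1 with hX'
  set Q' := Q - 1 with hQ'
  have e1 : P * X * Q - 1 = (X' + P' + Q') + (P' * Q' + P' * X' + X' * Q') + P' * X' * Q' := by
    simp only [hP', hX', hQ']; noncomm_ring
  rw [e1]
  have h1 : ‖P' * Q'‖ ≤ p * q := (norm_mul_le _ _).trans (mul_le_mul hP hQ (norm_nonneg _) hp0)
  have h2 : ‖P' * X'‖ ≤ p * x := (norm_mul_le _ _).trans (mul_le_mul hP hX (norm_nonneg _) hp0)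
  have h3 : ‖X' * Q'‖ ≤ x * q := (norm_mul_le _ _).trans (mul_le_mul hX hQ (norm_nonneg _) hx0)
  have h4 : ‖P' * X' * Q'‖ ≤ p * x * q :=
    (norm_mul_le _ _).trans (mul_le_mul h2 hQ (norm_nonneg _) (mul_nonneg hp0 hx0))
  calc _ ≤ ‖X' + P' + Q'‖ + ‖P' * Q' + P' * X' + X' * Q'‖ + ‖P' * X' * Q'‖ := norm_add₃_le
    _ ≤ (‖X'‖ + ‖P'‖ + ‖Q'‖) + (‖P' * Q'‖ + ‖P' * X'‖ + ‖X' * Q'‖) + ‖P' * X' * Q'‖ :=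
        add_le_add (add_le_add norm_add₃_le norm_add₃_le) le_rfl
    _ ≤ (x + p + q) + (p * q + p * x + x * q) + p * x * q := by gcongr
    _ = x + p + q + p * q + (p + q + p * q) * x := by ring

omit [NormOneClass 𝔸] in
/-- ★★ **(α) THE IN-BLOCK OSCILLATION OF THE AVERAGED GAUGE**, pure algebra over (84): if `R̄ʲu = u(Lʲ·)·w_j` at the two points `Lc` and `Lc + r` of the block of the level-`(j+1)`
site `c` (§1, global or local form), FILE 1 bounds the sample ratio `‖u(Lʲ⁺¹c)⁻¹·u(Lʲ(Lc + r)) − 1‖ ≤ x` and §2 the frames `‖w_j(Lc)⁻¹ − 1‖, ‖w_j(Lc + r) − 1‖ ≤ a`, then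
`‖R̄ʲu(Lc)⁻¹·R̄ʲu(Lc + r) − 1‖ ≤ x + 2a + a² + (2a + a²)·x` — NO unitarity used. [cite: Balaban1985Averaging, (84) p.30, (11) p.19; Balaban1985RegularSpaces, (1.29) p.81] -/
theorem norm_inv_uavg_mul_uavg_sub_one_le (L : ℕ) (W : Site d → Fin d → 𝔸ˣ) (u : Site d → 𝔸ˣ) (j : ℕ) (c : Site d) (r : Fin d → Fin L) {x a : ℝ}
    (h84c : uavg L (1 : Site d → Fin d → 𝔸ˣ) u j ((L : ℤ) • c) =
      u (((L : ℤ) ^ j) • ((L : ℤ) • c)) * wrec L (1 : Site d → Fin d → 𝔸ˣ) W j ((L : ℤ) • c))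
    (h84r : uavg L (1 : Site d → Fin d → 𝔸ˣ) u j ((L : ℤ) • c + boxVec L r) =
      u (((L : ℤ) ^ j) • ((L : ℤ) • c + boxVec L r)) * wrec L (1 : Site d → Fin d → 𝔸ˣ) W j ((L : ℤ) • c + boxVec L r))
    (hX : ‖(((u (((L : ℤ) ^ (j + 1)) • c))⁻¹ * u (((L : ℤ) ^ j) • ((L : ℤ) • c + boxVec L r)) : 𝔸ˣ) : 𝔸) - 1‖ ≤ x)
    (hwc : ‖(((wrec L (1 : Site d → Fin d → 𝔸ˣ) W j ((L : ℤ) • c))⁻¹ : 𝔸ˣ) : 𝔸) - 1‖ ≤ a)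
    (hwr : ‖((wrec L (1 : Site d → Fin d → 𝔸ˣ) W j ((L : ℤ) • c + boxVec L r) : 𝔸ˣ) : 𝔸) - 1‖ ≤ a) :
    ‖((((uavg L (1 : Site d → Fin d → 𝔸ˣ) u j ((L : ℤ) • c))⁻¹ * uavg L (1 : Site d → Fin d → 𝔸ˣ) u j ((L : ℤ) • c + boxVec L r) : 𝔸ˣ)) : 𝔸) - 1‖ ≤
      x + 2 * a + a ^ 2 + (2 * a + a ^ 2) * x := by
  rw [h84c, h84r]
  have e1 : ((L : ℤ) ^ j) • ((L : ℤ) • c) = ((L : ℤ) ^ (j + 1)) • c := by rw [smul_smul, pow_succ]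
  rw [e1]
  set wc := wrec L (1 : Site d → Fin d → 𝔸ˣ) W j ((L : ℤ) • c)
  set wr := wrec L (1 : Site d → Fin d → 𝔸ˣ) W j ((L : ℤ) • c + boxVec L r)
  set uc := u (((L : ℤ) ^ (j + 1)) • c)
  set ur := u (((L : ℤ) ^ j) • ((L : ℤ) • c + boxVec L r))
  have e2 : (uc * wc)⁻¹ * (ur * wr) = wc⁻¹ * (uc⁻¹ * ur) * wr := by group
  rw [e2, Units.val_mul, Units.val_mul]
  refine (norm_mul_mul_sub_one_le_of_sub_one hwc hX hwr).trans (le_of_eq ?_)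
  ring

end Summit.QuantumFields.YangMills.Theorems.HalvingOmegaRowWrec

end
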